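import Summits.CriticalPhenomena.PercolationContinuityZ3.Theorems.PercNearOneGluingNoHeavyLowerTailSahiCubeThreeAllOrders
import Mathlib.Tactic.FinCases
import Mathlib.Tactic.Linarith
import Mathlib.Tactic.Ring
import HarnessLib

/-!
# `NoHeavyLowerTail` (crux stmt-CriticalPhenomena-4575), master-family line P2 (Sahi's algebraic route):
# Sahi positivity of EVERY order on the five-point sunflower poset `M₃` is equivalent to ONE cubic inequality

Support file (seat `prim-masterthm-p2`, `--supports stmt-CriticalPhenomena-4575`); new mathematics, not in print
(memo `run/shared/lean/prim/prim-masterthm/prim-masterthm-p2/SAHI-ROUTE.md` §4); no named fact, no sorry.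

SETTING.  Three events `S₁, S₂, S₃` forming a Δ-system (`S_i ∩ S_j = K` for `i ≠ j`; e.g. a sunflower of monotone
events: the pairwise connections `{a~b}, {a~c}, {b~c}` of a percolation law, `K = {a~b~c}`, or the three `2|2` group
separations of four terminals = the open increasing E3GRP class `γ`; `β, r4, r5, r6` likewise) generate five cells:
core `K` (mass `a`), petals `C_i = S_i ∖ K` (masses `c_i`), outside `O` (mass `b`); the cell map is monotone onto the
poset `M₃ = {K < C₁, C₂, C₃ < O}`, and Sahi's `E_n` of monotone pattern-measurable functions under the law are the `E_n`
of monotone functions on `M₃` under the weight `ν = (a; c; b)` (they depend on joint moments only).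

**Theorem (`M3.sahiPositive_m3_iff`).**  For every probability weight `ν` on `M₃`:
`(∀ n, SahiPositive ν n) ↔ 0 ≤ (1 + a)(ab − e₂(c)) − e₃(c)`.  The right-hand side is `E₃(χ_{D₀}, χ_{D₁}, χ_{D₂})` for the
up-sets `D_i = {C_j, C_k, O} = S_iᶜ` (`M3.sahiE_three_D`) — the cubic of `Literature…sahiE3_compl_sunflower_eq`: `3PT-LB`
for the 3-point law (a theorem, `ThreePointLB.sahiE3_pairSep_nonneg`), the open row itself for `γ/β/r4–r6`.  This is the
`M₃`-analogue of Sahi's Prop. 15 [Sahi2008, p. 222] (`M₂ = {0,1}²`: all orders iff `E₂ ≥ 0` iff `αδ ≥ βγ`).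

PROOF.  (1) `sahiPositive_of_antichainBasis₂`: for an ARBITRARY probability weight on a finite preorder, all orders
follow from `E_k ≥ 0` on the ANTICHAIN families of up-sets of every size `k ≥ 2` (layer cake `sahiPositive_iff_indicators`
+ prim-sahi-p1's nested-pair peel `SahiCubeAllOrders.sahiE_setInd_nonneg_of_nested` [LiebSahi2021, Prop. 3.3]); the FKG version with
the pair layer supplied by FKG is `SahiCubeAllOrders.sahiPositive_of_antichainBasis`.  (2) The ten up-sets of `M₃` are
covered by three chains: `≥ 4` of them contain a nested pair, the antichain triples are the orderings of `(P₀,P₁,P₂)`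
(`P_i = {C_i, O}`) and of `(D₀,D₁,D₂)`, the antichain pairs are `(P_i,P_j), (D_i,D_j), (P_i,D_i), (D_i,P_i)` — kernel checks by
`decide`.  (3) `E₃(P₀,P₁,P₂) = b(1 − b)(1 + a) + b·e₂ + e₃ ≥ 0` always; the antichain pairs have
`E₂ ∈ {b(a + c_k) − c_ic_j, a(b + c_k) − c_ic_j, ab − c_i(c_j + c_k)}`, all `≥ 0` once `ab ≥ e₂(c)`, which the cubic implies.
-/

namespace Summit.CriticalPhenomena.PercolationContinuityZ3.Theorems.SahiDeltaSystem

open Finset Function Literature.Combinatorics.Sahi2008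

/-! ## Part 1.  Antichain basis for an arbitrary probability weight on a finite preorder -/

section General

variable {α : Type*} [Fintype α] [DecidableEq α]

/-- **Antichain basis, indicator form, arbitrary probability weight.**  If every ANTICHAIN (pairwise non-nested) family
of `k ≥ 2` up-sets has `E_k ≥ 0`, then every family of up-sets has `E_k ≥ 0` (induction on `k`, nested pairs peeled by prim-sahi-p1's
`SahiCubeAllOrders.sahiE_setInd_nonneg_of_nested`, order `1` trivial); no lattice/FKG structure — the pairs are part of the hypothesis. [this work] -/
theorem sahiE_setInd_nonneg_of_antichainBasis₂ [Preorder α] {μ : α → ℝ} (hμ0 : ∀ x, 0 ≤ μ x) (hμ1 : ∑ x, μ x = 1)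
    (H : ∀ (k : ℕ) (U : Fin (k + 2) → Finset α), (∀ i, IsUpperSet ((U i : Finset α) : Set α)) →
      (Pairwise fun i j => ¬ U j ⊆ U i) → 0 ≤ sahiE μ (k + 2) (fun i => setInd (U i))) :
    ∀ (k : ℕ) (U : Fin (k + 1) → Finset α), (∀ i, IsUpperSet ((U i : Finset α) : Set α)) →
      0 ≤ sahiE μ (k + 1) (fun i => setInd (U i)) := by
  intro k
  induction k with
  | zero =>
    intro U _
    rw [sahiE_one_apply]
    exact ex_nonneg hμ0 fun x => setInd_nonneg _ _
  | succ k ih =>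
    intro U hU
    by_cases hanti : Pairwise fun i j => ¬ U j ⊆ U i
    · exact H k U hU hanti
    · unfold Pairwise at hanti
      push Not at hanti
      obtain ⟨i, j, hij, hsub⟩ := hanti
      exact SahiCubeAllOrders.sahiE_setInd_nonneg_of_nested hμ0 hμ1 ih U hU hij hsub

/-- **Antichain basis of Sahi positivity, arbitrary probability weight on a finite preorder**: `E_k ≥ 0` on the antichain
families of up-sets of every size `k ≥ 2` implies `SahiPositive μ n` for EVERY `n` (layer cake + the indicator form); on a
poset whose up-set lattice has width `w` the hypothesis is a finite list (`k ≤ w`). [this work] -/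
theorem sahiPositive_of_antichainBasis₂ [Preorder α] {μ : α → ℝ} (hμ0 : ∀ x, 0 ≤ μ x) (hμ1 : ∑ x, μ x = 1)
    (H : ∀ (k : ℕ) (U : Fin (k + 2) → Finset α), (∀ i, IsUpperSet ((U i : Finset α) : Set α)) →
      (Pairwise fun i j => ¬ U j ⊆ U i) → 0 ≤ sahiE μ (k + 2) (fun i => setInd (U i)))
    (n : ℕ) : SahiPositive μ n := by
  match n with
  | 0 => exact sahiPositive_zero μ
  | k + 1 =>
    rw [sahiPositive_iff_indicators]
    exact sahiE_setInd_nonneg_of_antichainBasis₂ hμ0 hμ1 H k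

end General
/-! ## Part 2.  The five-point poset `M₃` -/

/-- The poset `M₃`: a bottom point `core` (the kernel of the Δ-system), three pairwise incomparable middle points
`pet i` (the petals) and a top point `out` (the outside). [this work] -/
inductive M3 : Type
  | core : M3 | pet : Fin 3 → M3 | out : M3
  deriving DecidableEq
namespace M3

/-- The order of `M₃` as a Boolean table: `core ≤ everything`, `pet i ≤ pet j ↔ i = j`, `pet i ≤ out`, `out ≤ out`.
[this work] -/
def leb : M3 → M3 → Bool
  | core, _ => true
  | pet i, pet j => decide (i = j)
  | pet _, out => true
  | out, out => true
  | _, _ => false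

/-- The order of `M₃` (from the table `leb`). [this work] -/
instance : LE M3 := ⟨fun x y => leb x y = true⟩

/-- The order of `M₃` is decidable (kernel-computable). [this work] -/
instance decLE : DecidableRel (α := M3) (· ≤ ·) := fun x y => inferInstanceAs (Decidable (leb x y = true))

/-- The five points of `M₃`. [this work] -/
instance : Fintype M3 where
  elems := {core, pet 0, pet 1, pet 2, out}
  complete := by
    intro x
    rcases x with _ | i | _ <;> [simp; (fin_cases i <;> simp); simp]

/-- `M₃` is a partial order (the order axioms are kernel checks on the table `leb`). [this work] -/
instance : PartialOrder M3 where
  le := (· ≤ ·)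
  le_refl := by decide
  le_trans := by decide
  le_antisymm := by decide

/-- The sum over `M₃` written out. [this work] -/
theorem sum_eq (f : M3 → ℝ) : ∑ x, f x = f core + f (pet 0) + f (pet 1) + f (pet 2) + f out := by
  show Finset.sum {core, pet 0, pet 1, pet 2, out} f = _
  rw [Finset.sum_insert (by decide), Finset.sum_insert (by decide), Finset.sum_insert (by decide),
    Finset.sum_insert (by decide), Finset.sum_singleton]
  ring

/-- Up-set-ness of a finite subset of `M₃`, in decidable form. [this work] -/
private def IsUp (U : Finset M3) : Prop := ∀ x ∈ U, ∀ y : M3, x ≤ y → y ∈ U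

/-- `IsUp` is decidable. [this work] -/
private instance instDecIsUp (U : Finset M3) : Decidable (IsUp U) := by
  unfold IsUp; infer_instance

/-- `IsUpperSet` on `M₃` in decidable form. [this work] -/
private theorem isUp_iff (U : Finset M3) : IsUpperSet ((U : Finset M3) : Set M3) ↔ IsUp U := by
  constructor
  · intro h x hx y hxy
    exact h hxy hx
  · intro h x y hxy hx
    exact h x hx y hxy

/-- `P i = {pet i, out}` (`= D_j ∩ D_k`). [this work] -/
def P (i : Fin 3) : Finset M3 := {pet i, out}
/-- `D i = {pet j, pet k, out}` (`j, k ≠ i`): the complement of the `i`-th event of the Δ-system. [this work] -/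
def D (i : Fin 3) : Finset M3 := (Finset.univ.erase core).erase (pet i)

/-- The ten up-sets of `M₃`. [this work] -/
private def ups : List (Finset M3) :=
  [∅, {out}, P 0, P 1, P 2, D 0, D 1, D 2, Finset.univ.erase core, Finset.univ]

/-- A finite subset of `M₃` is an up-set iff it is one of the ten listed ones (kernel check over the `32` subsets).
[this work] -/
private theorem isUp_iff_mem_ups (U : Finset M3) : IsUp U ↔ U ∈ ups := by
  revert U; decide

/-- A chain index: up-sets with the same index are nested (`∅ ⊂ B ⊂ P₀ ⊂ D₂ ⊂ W ⊂ ⊤`, `P₁ ⊂ D₀`, `P₂ ⊂ D₁`). [this work] -/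
private def cix (U : Finset M3) : Fin 3 := if U = P 1 ∨ U = D 0 then 1 else if U = P 2 ∨ U = D 1 then 2 else 0

/-- Up-sets with the same chain index are nested (kernel check). [this work] -/
private theorem nested_of_cix_eq : ∀ U ∈ ups, ∀ V ∈ ups, cix U = cix V → U ⊆ V ∨ V ⊆ U := by
  decide

/-- Among any `k + 4` up-sets of `M₃` two are nested. [this work] -/
theorem nested_of_four {k : ℕ} (U : Fin (k + 4) → Finset M3) (hU : ∀ i, IsUp (U i)) :
    ∃ i j, i ≠ j ∧ U j ⊆ U i := by
  have hcard : Fintype.card (Fin 3) < Fintype.card (Fin (k + 4)) := by simp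
  obtain ⟨i, j, hij, hc⟩ := Fintype.exists_ne_map_eq_of_card_lt (fun i => cix (U i)) hcard
  rcases nested_of_cix_eq (U i) ((isUp_iff_mem_ups _).1 (hU i)) (U j) ((isUp_iff_mem_ups _).1 (hU j)) hc with h | h
  · exact ⟨j, i, hij.symm, h⟩
  · exact ⟨i, j, hij, h⟩

/-- The `12` ordered antichain triples of up-sets of `M₃`: the orderings of `(P₀,P₁,P₂)` and of `(D₀,D₁,D₂)`.
[this work] -/
def tripleList : List (Finset M3 × Finset M3 × Finset M3) :=
  [(P 0, P 1, P 2), (P 0, P 2, P 1), (P 1, P 0, P 2), (P 1, P 2, P 0), (P 2, P 0, P 1), (P 2, P 1, P 0),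
    (D 0, D 1, D 2), (D 0, D 2, D 1), (D 1, D 0, D 2), (D 1, D 2, D 0), (D 2, D 0, D 1), (D 2, D 1, D 0)]

/-- The `18` ordered antichain pairs of up-sets of `M₃`. [this work] -/
def pairList : List (Finset M3 × Finset M3) :=
  [(P 0, P 1), (P 0, P 2), (P 1, P 0), (P 1, P 2), (P 2, P 0), (P 2, P 1), (D 0, D 1), (D 0, D 2), (D 1, D 0),
    (D 1, D 2), (D 2, D 0), (D 2, D 1), (P 0, D 0), (P 1, D 1), (P 2, D 2), (D 0, P 0), (D 1, P 1), (D 2, P 2)]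

/-- Classification of the antichain triples of up-sets of `M₃` (kernel check over the `10³` triples of up-sets).
[this work] -/
private theorem antichain_three_mem : ∀ U ∈ ups, ∀ V ∈ ups, ∀ X ∈ ups,
    ¬ U ⊆ V → ¬ V ⊆ U → ¬ U ⊆ X → ¬ X ⊆ U → ¬ V ⊆ X → ¬ X ⊆ V → (U, V, X) ∈ tripleList := by
  decide

/-- Classification of the antichain pairs of up-sets of `M₃` (kernel check). [this work] -/
private theorem antichain_two_mem : ∀ U ∈ ups, ∀ V ∈ ups, ¬ U ⊆ V → ¬ V ⊆ U → (U, V) ∈ pairList := by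
  decide

section Weight

variable (ν : M3 → ℝ)

/-- `E(χ_U · χ_V · …)` on `M₃`, evaluated cell by cell (the simp set used below). [this work] -/
theorem ex_eq (f : M3 → ℝ) :
    ex ν f = ν core * f core + ν (pet 0) * f (pet 0) + ν (pet 1) * f (pet 1) + ν (pet 2) * f (pet 2) + ν out * f out := by
  rw [ex_def, sum_eq]

/-- Total mass one, written out. [this work] -/
theorem sum_one_eq {ν : M3 → ℝ} (hν1 : ∑ x, ν x = 1) : ν core + ν (pet 0) + ν (pet 1) + ν (pet 2) + ν out = 1 := by
  rw [← sum_eq]; exact hν1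

/-- **The cubic of the algebra.**  `E₃(χ_{D₀}, χ_{D₁}, χ_{D₂}) = (1 + a)(ab − e₂(c)) − e₃(c)` with `a = ν(core)`,
`b = ν(out)`, `c_i = ν(pet i)` (the tree's `sahiE3_compl_sunflower_eq`, here on the five-point poset). [this work] -/
theorem sahiE_three_D {ν : M3 → ℝ} (hν1 : ∑ x, ν x = 1) :
    sahiE ν 3 ![setInd (D 0), setInd (D 1), setInd (D 2)] =
      (1 + ν core) * (ν core * ν out -
          (ν (pet 0) * ν (pet 1) + ν (pet 0) * ν (pet 2) + ν (pet 1) * ν (pet 2))) -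
        ν (pet 0) * ν (pet 1) * ν (pet 2) := by
  have hs := sum_one_eq hν1
  have hb : ν out = 1 - ν core - ν (pet 0) - ν (pet 1) - ν (pet 2) := by linarith
  rw [sahiE_three]
  simp [ex_eq, setInd_apply, D]
  rw [hb]; ring

/-- `E₃(χ_{P₀}, χ_{P₁}, χ_{P₂}) = b(1 − b)(1 + a) + b·e₂(c) + e₃(c) ≥ 0` for EVERY probability weight (the
'increasing triple' of a sunflower, cf. `sahiE3_sunflower_nonneg`). [this work] -/
theorem sahiE_three_P_nonneg {ν : M3 → ℝ} (hν0 : ∀ x, 0 ≤ ν x) (hν1 : ∑ x, ν x = 1) :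
    0 ≤ sahiE ν 3 ![setInd (P 0), setInd (P 1), setInd (P 2)] := by
  have hs := sum_one_eq hν1
  have ha := hν0 core; have hb := hν0 out; have h0 := hν0 (pet 0); have h1 := hν0 (pet 1); have h2 := hν0 (pet 2)
  rw [sahiE_three]
  simp [ex_eq, setInd_apply, P]
  have key : 0 ≤ ν out * (1 - ν out) * (1 + ν core) := mul_nonneg (mul_nonneg hb (by linarith)) (by linarith)
  nlinarith [key, mul_nonneg hb (mul_nonneg h0 h1), mul_nonneg hb (mul_nonneg h0 h2), mul_nonneg hb (mul_nonneg h1 h2),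
    mul_nonneg h0 (mul_nonneg h1 h2)]

/-- From the cubic: `ab ≥ e₂(c)` (hence Gladkov's three-petal inequality holds on `M₃` whenever the cubic does).
[this work] -/
theorem ab_ge_e₂_of_cubic {ν : M3 → ℝ} (hν0 : ∀ x, 0 ≤ ν x) (hν1 : ∑ x, ν x = 1)
    (h : 0 ≤ sahiE ν 3 ![setInd (D 0), setInd (D 1), setInd (D 2)]) :
    ν (pet 0) * ν (pet 1) + ν (pet 0) * ν (pet 2) + ν (pet 1) * ν (pet 2) ≤ ν core * ν out := by
  rw [sahiE_three_D hν1] at h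
  have ha := hν0 core; have h0 := hν0 (pet 0); have h1 := hν0 (pet 1); have h2 := hν0 (pet 2)
  nlinarith [mul_nonneg h0 (mul_nonneg h1 h2), mul_nonneg ha (mul_nonneg h0 (mul_nonneg h1 h2))]

/-- **Order 2 on the antichain pairs.**  Every ordered antichain pair `(U, V)` of up-sets of `M₃` has
`E₂(χ_U, χ_V) ≥ 0` once `ab ≥ e₂(c)` (the three shapes are `b(a + c_k) − c_ic_j`, `a(b + c_k) − c_ic_j`,
`ab − c_i(c_j + c_k)`). [this work] -/
theorem sahiE_two_nonneg_of_mem_pairList {ν : M3 → ℝ} (hν0 : ∀ x, 0 ≤ ν x) (hν1 : ∑ x, ν x = 1)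
    (hG : ν (pet 0) * ν (pet 1) + ν (pet 0) * ν (pet 2) + ν (pet 1) * ν (pet 2) ≤ ν core * ν out)
    {U V : Finset M3} (hUV : (U, V) ∈ pairList) : 0 ≤ sahiE ν 2 ![setInd U, setInd V] := by
  have hs := sum_one_eq hν1
  have ha := hν0 core; have hb := hν0 out; have h0 := hν0 (pet 0); have h1 := hν0 (pet 1); have h2 := hν0 (pet 2)
  have hb0 := mul_nonneg hb h0; have hb1 := mul_nonneg hb h1; have hb2 := mul_nonneg hb h2
  have ha0 := mul_nonneg ha h0; have ha1 := mul_nonneg ha h1; have ha2 := mul_nonneg ha h2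
  have h01 := mul_nonneg h0 h1; have h02 := mul_nonneg h0 h2; have h12 := mul_nonneg h1 h2
  simp only [pairList, List.mem_cons, Prod.mk.injEq, List.not_mem_nil, or_false] at hUV
  rcases hUV with ⟨rfl, rfl⟩ | ⟨rfl, rfl⟩ | ⟨rfl, rfl⟩ | ⟨rfl, rfl⟩ | ⟨rfl, rfl⟩ | ⟨rfl, rfl⟩ | ⟨rfl, rfl⟩ | ⟨rfl, rfl⟩ |
    ⟨rfl, rfl⟩ | ⟨rfl, rfl⟩ | ⟨rfl, rfl⟩ | ⟨rfl, rfl⟩ | ⟨rfl, rfl⟩ | ⟨rfl, rfl⟩ | ⟨rfl, rfl⟩ | ⟨rfl, rfl⟩ |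
    ⟨rfl, rfl⟩ | ⟨rfl, rfl⟩
  all_goals
    rw [sahiE_two]
    simp [ex_eq, setInd_apply, P, D]
    nlinarith

/-- **Order 3 on the antichain triples.**  Every ordered antichain triple of up-sets of `M₃` has `E₃ ≥ 0` once
`E₃(χ_{D₀}, χ_{D₁}, χ_{D₂}) ≥ 0` (the orderings of the `P`-triple are `≥ 0` for every weight; the orderings of the
`D`-triple have the same value as the hypothesis, `E₃` being symmetric). [this work] -/
theorem sahiE_three_nonneg_of_mem_tripleList {ν : M3 → ℝ} (hν0 : ∀ x, 0 ≤ ν x) (hν1 : ∑ x, ν x = 1)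
    (h : 0 ≤ sahiE ν 3 ![setInd (D 0), setInd (D 1), setInd (D 2)]) {U V X : Finset M3}
    (hUVX : (U, V, X) ∈ tripleList) : 0 ≤ sahiE ν 3 ![setInd U, setInd V, setInd X] := by
  have hs := sum_one_eq hν1
  have ha := hν0 core; have hb := hν0 out; have h0 := hν0 (pet 0); have h1 := hν0 (pet 1); have h2 := hν0 (pet 2)
  have hP := sahiE_three_P_nonneg hν0 hν1
  have hD := h
  rw [sahiE_three] at hP hD
  simp [ex_eq, setInd_apply, P, D] at hP hD
  simp only [tripleList, List.mem_cons, Prod.mk.injEq, List.not_mem_nil, or_false] at hUVX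
  rcases hUVX with ⟨rfl, rfl, rfl⟩ | ⟨rfl, rfl, rfl⟩ | ⟨rfl, rfl, rfl⟩ | ⟨rfl, rfl, rfl⟩ | ⟨rfl, rfl, rfl⟩ |
    ⟨rfl, rfl, rfl⟩ | ⟨rfl, rfl, rfl⟩ | ⟨rfl, rfl, rfl⟩ | ⟨rfl, rfl, rfl⟩ | ⟨rfl, rfl, rfl⟩ | ⟨rfl, rfl, rfl⟩ |
    ⟨rfl, rfl, rfl⟩
  all_goals
    rw [sahiE_three]
    simp [ex_eq, setInd_apply, P, D]
    nlinarith

/-- **Sahi positivity of every order on `M₃` from the single cubic.**  If `ν` is a probability weight on `M₃`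
with `E₃(χ_{D₀}, χ_{D₁}, χ_{D₂}) ≥ 0`, then `E_n(f₀,…,f_{n−1}) ≥ 0` for every `n` and all nonnegative increasing
`f_i : M₃ → ℝ`. [this work] -/
theorem sahiPositive_of_cubic {ν : M3 → ℝ} (hν0 : ∀ x, 0 ≤ ν x) (hν1 : ∑ x, ν x = 1)
    (h : 0 ≤ sahiE ν 3 ![setInd (D 0), setInd (D 1), setInd (D 2)]) (n : ℕ) : SahiPositive ν n := by
  refine sahiPositive_of_antichainBasis₂ hν0 hν1 ?_ n
  intro k U hU hanti
  have hU' : ∀ i, U i ∈ ups := fun i => (isUp_iff_mem_ups _).1 ((isUp_iff _).1 (hU i))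
  match k with
  | 0 =>
    have hmem := antichain_two_mem (U 0) (hU' 0) (U 1) (hU' 1) (hanti (show (1 : Fin 2) ≠ 0 by decide))
      (hanti (show (0 : Fin 2) ≠ 1 by decide))
    have hfam : (fun i => setInd (U i)) = ![setInd (U 0), setInd (U 1)] := by funext i; fin_cases i <;> rfl
    rw [hfam]
    exact sahiE_two_nonneg_of_mem_pairList hν0 hν1 (ab_ge_e₂_of_cubic hν0 hν1 h) hmem
  | 1 =>
    have hmem := antichain_three_mem (U 0) (hU' 0) (U 1) (hU' 1) (U 2) (hU' 2)
      (hanti (show (1 : Fin 3) ≠ 0 by decide)) (hanti (show (0 : Fin 3) ≠ 1 by decide))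
      (hanti (show (2 : Fin 3) ≠ 0 by decide)) (hanti (show (0 : Fin 3) ≠ 2 by decide))
      (hanti (show (2 : Fin 3) ≠ 1 by decide)) (hanti (show (1 : Fin 3) ≠ 2 by decide))
    have hfam : (fun i => setInd (U i)) = ![setInd (U 0), setInd (U 1), setInd (U 2)] := by
      funext i; fin_cases i <;> rfl
    rw [hfam]
    exact sahiE_three_nonneg_of_mem_tripleList hν0 hν1 h hmem
  | k + 2 =>
    exfalso
    obtain ⟨i, j, hij, hsub⟩ := nested_of_four U fun i => (isUp_iff _).1 (hU i)
    exact hanti hij hsub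

/-- **Theorem (`M₃`-analogue of Sahi's Prop. 15).**  For a probability weight `ν` on the five-point sunflower
poset `M₃`: Sahi positivity of EVERY order `n` holds iff the single cubic
`(1 + a)(ab − e₂(c)) − e₃(c) ≥ 0`, `a = ν(core)`, `b = ν(out)`, `c_i = ν(pet i)`.  (For the 3-point percolation law
with `core = {a~b~c}` this cubic is `3PT-LB`, a theorem; for the increasing E3GRP classes `β, γ, r4–r6` it is the
open row itself — see the module docstring.) [this work] -/
theorem sahiPositive_m3_iff {ν : M3 → ℝ} (hν0 : ∀ x, 0 ≤ ν x) (hν1 : ∑ x, ν x = 1) :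
    (∀ n, SahiPositive ν n) ↔
      0 ≤ (1 + ν core) * (ν core * ν out -
          (ν (pet 0) * ν (pet 1) + ν (pet 0) * ν (pet 2) + ν (pet 1) * ν (pet 2))) -
        ν (pet 0) * ν (pet 1) * ν (pet 2) := by
  rw [← sahiE_three_D hν1]
  constructor
  · intro hall
    have hD : ∀ i : Fin 3, IsUpperSet ((D i : Finset M3) : Set M3) := by
      intro i
      rw [isUp_iff, isUp_iff_mem_ups]
      fin_cases i <;> decide
    have h3 := (sahiPositive_iff_indicators ν 3).1 (hall 3) (fun i => D i) fun i => hD i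
    have e : (fun i : Fin 3 => setInd (D i)) = ![setInd (D 0), setInd (D 1), setInd (D 2)] := by
      funext i; fin_cases i <;> rfl
    rw [e] at h3
    exact h3
  · intro h n
    exact sahiPositive_of_cubic hν0 hν1 h n

end Weight

end M3
end Summit.CriticalPhenomena.PercolationContinuityZ3.Theorems.SahiDeltaSystem
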